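import Literature.IUT.LogThetaLattice.GlobalFrobenioidModelsTransport
import HarnessLib

/-!
# [IUTchIII] Ex. 3.6 (i) / Prop. 3.10 (i)(iii): transport of the rational-function-TORSOR version `𝓕⊛_MOD`
# along an isomorphism of number fields, the Kummer EQUIVALENCE of categories, and the Prop. 3.10 (i)
# signature instantiated by a Kummer column (companion of `GlobalFrobenioidModelsTransport.lean`)

Bridge file (abc-iut cell, D-0067 wave 4, seat abc-iut-w4-d002). S. Mochizuki, *Inter-universal Teichmüller
theory III*, kurims manuscript (May 2020), Ex. 3.6 (i) p. 107 (objects of `𝓕⊛_MOD`: an `F^×_mod`-torsor `T`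
with local trivializations `t_v`), Prop. 3.10 (iii) p. 149 / Rmk. 3.10.1 (i) pp. 149–150 (the Kummer
isomorphisms "induce … isomorphisms of Frobenioids `(^{n,m}𝓕⊛_MOD)_α ⥲ 𝓕⊛_MOD(^{n,∘}𝓗𝓣^𝒟)_α` … precisely
because the construction of '`(†𝓕⊛_MOD)_α`' only involves the group '`(†𝕄⊛_MOD)_α`' …"); claim key
Mochizuki2012, DISPUTED (D-0012). `GlobalFrobenioidModelsTransport.lean` makes the functorial algorithm of
Prop. 3.7 (i) REAL on the Ex. 3.6 (ii) object type `FrakObj`; THIS file does the same for abc-iut-L6-t4's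
Ex. 3.6 (i) TORSOR objects `MODObj` (the literal `𝓕⊛_MOD` of Prop. 3.10 (iii)):

* `MODObj.transport σ e hβ X` — along a field isomorphism `σ : F ≃+* F'` and a bijection of places `e`
  under which the `β_v` correspond, an `F^×`-torsor with trivializations becomes an `F'^×`-torsor with
  trivializations (same underlying set; `F'^×` acts through `σ⁻¹`; `t'_{e v} := t_v`), the almost-all
  condition being preserved;
* `ElemHom.transport` — elementary morphisms are carried along (same bijection of torsors);
* `FrakObj.toMOD_reindex` — the transport INTERTWINES abc-iut-L6-t4's identification `𝓕⊛_𝔪𝔬𝔡 → 𝓕⊛_MOD`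
  (`FrakObj.toMOD`, Ex. 3.6 (iii)) with the `FrakObj` transport of `GlobalFrobenioidModelsTransport.lean`, up
  to the evident isomorphism of torsors `σ : F^× ⥲ F'^×` (an elementary isomorphism in `𝓕⊛_MOD(F')`);
* `MODObj.modelTransport σ` — the instance at the MODEL place data (`placesEquiv σ`, `betaModel_placesEquiv`);
* `frakCatEquivalence σ : FrakCat K … ≌ FrakCat K' …` — the functor `frakCatTransport σ` of the companion file
  is an EQUIVALENCE of categories (inverse: transport along `σ⁻¹`; unit/counit are `eqToIso`s);
* `VerticallyCoricGlobalData.ofKummerColumn` — the OUTPUT SIGNATURE of Prop. 3.10 (i) INSTANTIATED by a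
  Kummer column of fields with the model Frobenioid objects, and `…ofKummerColumn_prop310iii`: the
  statement-level discharge theorem of (iii) (p411539) applied to it — all its named hypotheses realised.

HONEST SCOPE: object- and elementary-morphism-level transport; the functoriality laws (`refl`/`trans`) are
recorded for the `FrakObj` version (`frakTransport_trans`), to which this version is isomorphic object by
object (`FrakObj.toMOD_reindex` + abc-iut-L6-t4's `FrakObj.toMOD`); nothing here takes a side on [IUTchIII]
Cor. 3.12; typed ≠ discharged elsewhere.
-/

noncomputable section

namespace Literature.IUT.LogThetaLattice

namespace GlobalFrobenioidModels

open NumberField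

universe u v v' w

section Torsor

variable {F F' : Type u} [Field F] [Field F'] {V : Type v} {V' : Type v'} {G : Type w} [AddCommGroup G]
  {nonneg : V → AddSubmonoid G} {nonneg' : V' → AddSubmonoid G}
  {β : V → (Additive Fˣ →+ G)} {β' : V' → (Additive F'ˣ →+ G)}

/-- The additive form `F'^× ⥲ F^×` of `σ⁻¹` through which `F'^×` acts on a transported torsor.
([IUTchIII] Ex 3.6 (i) p.107) [claim: Mochizuki2012, status: disputed] -/
def unitsAddEquivSymm (σ : F ≃+* F') : Additive F'ˣ ≃+ Additive Fˣ :=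
  MulEquiv.toAdditive (Units.mapEquiv σ.symm.toMulEquiv)

/-- `unitsAddEquivSymm σ (σ f) = f`. ([IUTchIII] Ex 3.6 (i) p.107) [claim: Mochizuki2012, status: disputed] -/
@[simp] theorem unitsAddEquivSymm_map (σ : F ≃+* F') (f : Fˣ) :
    unitsAddEquivSymm σ (Additive.ofMul (Units.map (σ : F →* F') f)) = Additive.ofMul f := by
  change Additive.ofMul (Units.mapEquiv σ.symm.toMulEquiv (Units.map (σ : F →* F') f)) = Additive.ofMul f
  congr 1
  ext
  simp

/-- `σ (unitsAddEquivSymm σ g') = g'`. ([IUTchIII] Ex 3.6 (i) p.107) [claim: Mochizuki2012, status: disputed] -/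
@[simp] theorem map_unitsAddEquivSymm (σ : F ≃+* F') (g' : Additive F'ˣ) :
    Additive.ofMul (Units.map (σ : F →* F') (Additive.toMul (unitsAddEquivSymm σ g'))) = g' := by
  change Additive.ofMul (Units.map (σ : F →* F') (Units.mapEquiv σ.symm.toMulEquiv (Additive.toMul g'))) = g'
  conv_rhs => rw [← ofMul_toMul g']
  congr 1
  ext
  simp

/-- **The `F'^×`-torsor structure on the underlying set of an `F^×`-torsor, acting through `σ⁻¹`**
(change of structure group along the isomorphism `σ : F^× ⥲ F'^×`). ([IUTchIII] Ex 3.6 (i) p.107)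
[claim: Mochizuki2012, status: disputed] -/
@[reducible] def torsorTransport (σ : F ≃+* F') (T : Type*) [AddTorsor (Additive Fˣ) T] :
    AddTorsor (Additive F'ˣ) T :=
  { AddAction.compHom T (unitsAddEquivSymm σ).toAddMonoidHom with
    vsub := fun p q => (unitsAddEquivSymm σ).symm (p -ᵥ q)
    nonempty := inferInstance
    vsub_vadd' := fun p q => by
      change unitsAddEquivSymm σ ((unitsAddEquivSymm σ).symm (p -ᵥ q)) +ᵥ q = p
      rw [AddEquiv.apply_symm_apply, vsub_vadd]
    vadd_vsub' := fun g p => by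
      change (unitsAddEquivSymm σ).symm ((unitsAddEquivSymm σ g +ᵥ p) -ᵥ p) = g
      rw [vadd_vsub, AddEquiv.symm_apply_apply] }

/-- **Transport of an object of `𝓕⊛_MOD` (Ex. 3.6 (i): torsor + local trivializations) along `σ : F ≃+* F'`
and a bijection of places `e` under which the `β_v` correspond**: same underlying torsor, `F'^×` acting
through `σ⁻¹`, trivializations `t'_{v'} := t_{e⁻¹ v'}`; `β_{v'}`-equivariance and the "all but finitely
many `v`" condition are PROVED. This is the object part of the functorial algorithm of Prop. 3.7 (i) on the
torsor model, hence of the Kummer isomorphism of Frobenioids of Prop. 3.10 (i)/(iii) when `σ` is a Kummer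
isomorphism of number fields. ([IUTchIII] Ex 3.6 (i) p.107; Prop 3.10 (iii) p.149) [claim: Mochizuki2012, status: disputed] -/
def MODObj.transport (σ : F ≃+* F') (e : V ≃ V')
    (hβ : ∀ v (f : Fˣ), β' (e v) (Additive.ofMul (Units.map (σ : F →* F') f)) = β v (Additive.ofMul f))
    (X : MODObj F V (fun _ => G) β) : MODObj F' V' (fun _ => G) β' where
  T := X.T
  instTorsor := torsorTransport σ X.T
  t v' x := X.t (e.symm v') x
  equivariant v' g' x := by
    obtain ⟨v, rfl⟩ := e.surjective v'
    have hg : β' (e v) g' = β v (unitsAddEquivSymm σ g') := by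
      conv_lhs => rw [← map_unitsAddEquivSymm σ g']
      rw [hβ, ofMul_toMul]
    change X.t (e.symm (e v)) (unitsAddEquivSymm σ g' +ᵥ x) = β' (e v) g' + X.t (e.symm (e v)) x
    rw [Equiv.symm_apply_apply, X.equivariant, hg]
  almostAll := by
    obtain ⟨x, hx⟩ := X.almostAll
    exact ⟨x, hx.preimage e.symm.injective.injOn⟩

/-- The underlying set of the transported torsor is unchanged (definitional). ([IUTchIII] Ex 3.6 (i) p.107)
[claim: Mochizuki2012, status: disputed] -/
theorem MODObj.transport_T (σ : F ≃+* F') (e : V ≃ V')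
    (hβ : ∀ v (f : Fˣ), β' (e v) (Additive.ofMul (Units.map (σ : F →* F') f)) = β v (Additive.ofMul f))
    (X : MODObj F V (fun _ => G) β) : (X.transport σ e hβ).T = X.T := rfl

/-- **Elementary morphisms are carried along the transport** (same bijection of torsors; equivariance
through `σ⁻¹`; integrality at `v' = e v` is integrality at `v` when the cones correspond).
([IUTchIII] Ex 3.6 (i) p.107) [claim: Mochizuki2012, status: disputed] -/
def ElemHom.transport (σ : F ≃+* F') (e : V ≃ V') (hn : ∀ v, nonneg' (e v) = nonneg v)
    (hβ : ∀ v (f : Fˣ), β' (e v) (Additive.ofMul (Units.map (σ : F →* F') f)) = β v (Additive.ofMul f))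
    {X Y : MODObj F V (fun _ => G) β} (φ : ElemHom (nonneg := nonneg) X Y) :
    ElemHom (nonneg := nonneg') (X.transport σ e hβ) (Y.transport σ e hβ) where
  toEquiv := φ.toEquiv
  map_vadd g' x := φ.map_vadd (unitsAddEquivSymm σ g') x
  integral v' x := by
    obtain ⟨v, rfl⟩ := e.surjective v'
    change Y.t (e.symm (e v)) (φ.toEquiv x) - X.t (e.symm (e v)) x ∈ nonneg' (e v)
    rw [Equiv.symm_apply_apply, hn]
    exact φ.integral v x

/-- **The torsor transport intertwines the identification `𝓕⊛_𝔪𝔬𝔡 → 𝓕⊛_MOD`** (abc-iut-L6-t4's `FrakObj.toMOD`,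
Ex. 3.6 (iii)) **with the `FrakObj` transport**: the additive form of `σ : F^× ⥲ F'^×` is an ELEMENTARY
ISOMORPHISM in `𝓕⊛_MOD(F')` from the transport of `𝔍.toMOD` to `(e_* 𝔍).toMOD` (integrality holds with
equality, `0 ∈ Γ^{≥0}`). ([IUTchIII] Ex 3.6 (iii) p.108; Prop 3.10 (iii) p.149) [claim: Mochizuki2012, status: disputed] -/
def FrakObj.toMOD_reindex (σ : F ≃+* F') (e : V ≃ V')
    (hβ : ∀ v (f : Fˣ), β' (e v) (Additive.ofMul (Units.map (σ : F →* F') f)) = β v (Additive.ofMul f))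
    (J : FrakObj V (fun _ => G)) :
    ElemHom (nonneg := nonneg') ((J.toMOD (F := F) (β := β)).transport σ e hβ)
      ((J.reindex e).toMOD (F := F') (β := β')) where
  toEquiv := ((unitsAddEquivSymm σ).symm : Additive Fˣ ≃+ Additive F'ˣ).toEquiv
  map_vadd g' x := by
    have key : ∀ y : Additive Fˣ, (unitsAddEquivSymm σ).symm (unitsAddEquivSymm σ g' + y) =
        g' + (unitsAddEquivSymm σ).symm y := fun y => by
      rw [map_add, AddEquiv.symm_apply_apply]
    exact key x
  integral v' x := by
    obtain ⟨v, rfl⟩ := e.surjective v'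
    have key : ∀ y : Additive Fˣ, β' (e v) ((unitsAddEquivSymm σ).symm y) - (J.reindex e).cls (e v) -
        (β (e.symm (e v)) y - J.cls (e.symm (e v))) ∈ nonneg' (e v) := fun y => by
      have hy : (unitsAddEquivSymm σ).symm y =
          Additive.ofMul (Units.map (σ : F →* F') (Additive.toMul y)) := by
        apply (unitsAddEquivSymm σ).injective
        rw [AddEquiv.apply_symm_apply, unitsAddEquivSymm_map, ofMul_toMul]
      rw [hy, hβ, ofMul_toMul, FrakObj.reindex_cls, Equiv.symm_apply_apply, sub_self]
      exact (nonneg' (e v)).zero_mem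
    exact key x

end Torsor

section Model

variable {K K' : Type u} [Field K] [NumberField K] [Field K'] [NumberField K']

/-- **The Kummer transport of the MODEL `𝓕⊛_MOD(K)`** (torsor objects over all places of `K`, `β_v = ord_v`
resp. `−log|·|_v`) along `σ : K ≃+* K'`: the instance of `MODObj.transport` at `placesEquiv σ`,
`betaModel_placesEquiv`. ([IUTchIII] Prop 3.10 (iii) p.149) [claim: Mochizuki2012, status: disputed] -/
def MODObj.modelTransport (σ : K ≃+* K') (X : MODObj K (ModelPlaces K) (fun _ => ℝ) betaModel) :
    MODObj K' (ModelPlaces K') (fun _ => ℝ) betaModel :=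
  X.transport σ (placesEquiv σ) (betaModel_placesEquiv σ)

/-- Elementary morphisms of the model `𝓕⊛_MOD(K)` are carried to elementary morphisms of `𝓕⊛_MOD(K')`.
([IUTchIII] Prop 3.10 (iii) p.149) [claim: Mochizuki2012, status: disputed] -/
def ElemHom.modelTransport (σ : K ≃+* K') {X Y : MODObj K (ModelPlaces K) (fun _ => ℝ) betaModel}
    (φ : ElemHom (nonneg := nonnegModel) X Y) :
    ElemHom (nonneg := nonnegModel) (X.modelTransport σ) (Y.modelTransport σ) :=
  φ.transport σ (placesEquiv σ) (nonnegModel_placesEquiv σ) (betaModel_placesEquiv σ)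

/-- At the model, the torsor transport of `𝔍.toMOD` is elementarily isomorphic to `(σ_* 𝔍).toMOD`
(consistency of the two functorial algorithms under Ex. 3.6 (iii)). ([IUTchIII] Prop 3.10 (iii) p.149)
[claim: Mochizuki2012, status: disputed] -/
def FrakObj.toMOD_frakTransport (σ : K ≃+* K') (J : FrakObj (ModelPlaces K) (fun _ => ℝ)) :
    ElemHom (nonneg := nonnegModel) ((J.toMOD (F := K) (β := betaModel)).modelTransport σ)
      ((frakTransport σ J).toMOD (F := K') (β := betaModel)) :=
  FrakObj.toMOD_reindex σ (placesEquiv σ) (betaModel_placesEquiv σ) J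

end Model

section CategoryEquivalence

open CategoryTheory

variable {K K' : Type} [Field K] [NumberField K] [Field K'] [NumberField K']

/-- The Frobenius degree of an `eqToHom` in `𝓕⊛_𝔪𝔬𝔡` is `1`. ([IUTchIII] Ex 3.6 (ii) p.108)
[claim: Mochizuki2012, status: disputed] -/
theorem FrakCat.deg_eqToHom {X Y : FrakCat K (ModelPlaces K) (fun _ => ℝ) nonnegModel betaModel}
    (h : X = Y) : FrakCat.deg (eqToHom h) = 1 := by
  subst h
  rfl

/-- The element of an `eqToHom` in `𝓕⊛_𝔪𝔬𝔡` is `1`. ([IUTchIII] Ex 3.6 (ii) p.108)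
[claim: Mochizuki2012, status: disputed] -/
theorem FrakCat.fn_eqToHom {X Y : FrakCat K (ModelPlaces K) (fun _ => ℝ) nonnegModel betaModel}
    (h : X = Y) : FrakCat.fn (eqToHom h) = 1 := by
  subst h
  rfl

omit [NumberField K] [NumberField K'] in
/-- `σ⁻¹ (σ f) = f` on units. ([IUTchIII] Ex 3.6 (ii) p.108) [claim: Mochizuki2012, status: disputed] -/
theorem units_map_symm_map (σ : K ≃+* K') (f : Kˣ) :
    Units.map (σ.symm : K' →* K) (Units.map (σ : K →* K') f) = f :=
  Units.ext (σ.symm_apply_apply (f : K))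

omit [NumberField K] [NumberField K'] in
/-- `σ (σ⁻¹ f') = f'` on units. ([IUTchIII] Ex 3.6 (ii) p.108) [claim: Mochizuki2012, status: disputed] -/
theorem units_map_map_symm (σ : K ≃+* K') (f' : K'ˣ) :
    Units.map (σ : K →* K') (Units.map (σ.symm : K' →* K) f') = f' :=
  Units.ext (σ.apply_symm_apply (f' : K'))

/-- On morphisms `frakCatTransport σ` keeps the Frobenius degree (definitional). ([IUTchIII] Prop 3.7 (i) p.109)
[claim: Mochizuki2012, status: disputed] -/
@[simp] theorem deg_frakCatTransport_map (σ : K ≃+* K')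
    {X Y : FrakCat K (ModelPlaces K) (fun _ => ℝ) nonnegModel betaModel} (φ : X ⟶ Y) :
    FrakCat.deg ((frakCatTransport σ).map φ) = FrakCat.deg φ := rfl

/-- On morphisms `frakCatTransport σ` applies `σ` to the element `f ∈ K^×` (definitional).
([IUTchIII] Prop 3.7 (i) p.109) [claim: Mochizuki2012, status: disputed] -/
@[simp] theorem fn_frakCatTransport_map (σ : K ≃+* K')
    {X Y : FrakCat K (ModelPlaces K) (fun _ => ℝ) nonnegModel betaModel} (φ : X ⟶ Y) :
    FrakCat.fn ((frakCatTransport σ).map φ) = Units.map (σ : K →* K') (FrakCat.fn φ) := rfl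

/-- **The Kummer isomorphism of the model global Frobenioids is an EQUIVALENCE (indeed isomorphism) of
categories** `𝓕⊛_𝔪𝔬𝔡(K) ≌ 𝓕⊛_𝔪𝔬𝔡(K')`, with inverse the transport along `σ⁻¹` ([IUTchIII] Prop. 3.10 (i)
"Kummer isomorphisms of … Frobenioids", at the level of the underlying categories of abc-iut-L6-t6's
`FrakCat`; universe `0`). ([IUTchIII] Prop 3.10 (i) p.148) [claim: Mochizuki2012, status: disputed] -/
def frakCatEquivalence (σ : K ≃+* K') :
    FrakCat K (ModelPlaces K) (fun _ => ℝ) nonnegModel betaModel ≌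
      FrakCat K' (ModelPlaces K') (fun _ => ℝ) nonnegModel betaModel :=
  CategoryTheory.Equivalence.mk (frakCatTransport σ) (frakCatTransport σ.symm)
    (NatIso.ofComponents
      (fun X => eqToIso (by
        change X = FrakCat.of (frakTransport σ.symm (frakTransport σ X.obj))
        rw [← frakTransport_symm, Equiv.symm_apply_apply]
        rfl))
      (fun {X Y} φ => by
        apply FrakCat.hom_ext
        · simp [FrakCat.deg_eqToHom]
        · simp [FrakCat.fn_eqToHom, FrakCat.deg_eqToHom, units_map_symm_map]))
    (NatIso.ofComponents
      (fun X' => eqToIso (by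
        change FrakCat.of (frakTransport σ (frakTransport σ.symm X'.obj)) = X'
        rw [← frakTransport_symm, Equiv.apply_symm_apply]
        rfl))
      (fun {X' Y'} φ => by
        apply FrakCat.hom_ext
        · simp [FrakCat.deg_eqToHom]
        · simp [FrakCat.fn_eqToHom, FrakCat.deg_eqToHom, units_map_map_symm]))

end CategoryEquivalence

section KummerColumn

variable {Kf : ℤ → Type u} [∀ m, Field (Kf m)] {Kc : Type u} [Field Kc]

/-- The type of "Frobenioids in play" for a Kummer column at the model: the Frobenius-like copies indexed by
`m ∈ ℤ` and the vertically coric copy `∘`. ([IUTchIII] Prop 3.10 (i) p.147) [claim: Mochizuki2012, status: disputed] -/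
abbrev ColumnIndex : Type u := ULift.{u} (ℤ ⊕ Unit)

/-- The MODEL global-Frobenioid object type attached to an index of the column (`FrakObj` over the model
places of `K_m` resp. `K_∘`). ([IUTchIII] Prop 3.10 (i) p.147) [claim: Mochizuki2012, status: disputed] -/
abbrev columnObjects (Kf : ℤ → Type u) [∀ m, Field (Kf m)] (Kc : Type u) [Field Kc] :
    ColumnIndex.{u} → Type u :=
  fun A => Sum.elim (fun m => FrakObj (ModelPlaces (Kf m)) (fun _ => ℝ))
    (fun _ => FrakObj (ModelPlaces Kc) (fun _ => ℝ)) A.down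

/-- **The OUTPUT SIGNATURE of [IUTchIII] Prop. 3.10 (i) INSTANTIATED by a Kummer column of fields at the
model**: `Mfrob m j := K_m`, `Mcoric j := K_∘`, `kummerField := κ_m`; Frobenioids and strips indexed by
`ℤ ⊔ {∘}` with isomorphism type := bijections of the model object types; Kummer isomorphisms of
Frobenioids / strips := the functorial algorithm `frakTransport (κ m)` (strips modelled by their global
component only — stated limitation). ([IUTchIII] Prop 3.10 (i) p.147) [claim: Mochizuki2012, status: disputed] -/
def VerticallyCoricGlobalData.ofKummerColumn (lstar : ℕ) (κ : ∀ m, Kf m ≃+* Kc) :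
    VerticallyCoricGlobalData lstar ColumnIndex.{u}
      (fun A B => columnObjects Kf Kc A ≃ columnObjects Kf Kc B) ColumnIndex.{u}
      (fun A B => columnObjects Kf Kc A ≃ columnObjects Kf Kc B) where
  Mcoric _ := Kc
  Mfrob m _ := Kf m
  kummerField m _ := κ m
  Fmod _ := ⟨Sum.inr ()⟩
  Ffrak _ := ⟨Sum.inr ()⟩
  FMOD _ := ⟨Sum.inr ()⟩
  isoModFrak _ := Equiv.refl _
  isoFrakMOD _ := Equiv.refl _
  FMODfrob m _ := ⟨Sum.inl m⟩
  kummerFMOD m _ := frakTransport (κ m)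
  Sgau := ⟨Sum.inr ()⟩
  SLGP := ⟨Sum.inr ()⟩
  Slgp := ⟨Sum.inr ()⟩
  isoGauLGP := Equiv.refl _
  isoLGPlgp := Equiv.refl _
  SLGPfrob m := ⟨Sum.inl m⟩
  kummerSLGP m := frakTransport (κ m)

/-- **Closing the loop**: the STATEMENT-LEVEL discharge theorem of Prop. 3.10 (iii)
(`VerticallyCoricGlobalData.prop310iii_frobenioids`, p411539) applied to these REAL data — every one of its
named hypotheses is realised (`onOb := id`, functorial algorithm `ΦK = ΦL := frakTransport`, functoriality
`hΦ := frakTransport_trans`, Kummer compatibility `hK := rfl`), and its conclusion is Prop. 3.10 (iii) at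
the model (the statement of `prop310iii_model`). ([IUTchIII] Prop 3.10 (iii) p.149) [claim: Mochizuki2012, status: disputed] -/
theorem VerticallyCoricGlobalData.ofKummerColumn_prop310iii (lstar : ℕ) (κ : ∀ m, Kf m ≃+* Kc)
    (j : Fin lstar) :
    Literature.IUT.LogThetaLattice.Prop310iii_compatible
      (fun m => FrakObj (ModelPlaces (Kf m)) (fun _ => ℝ))
      (fun m => frakTransport (κ m))
      (fun m => ⇑(frakTransport ((κ m).trans (κ (m + 1)).symm))) :=
  (VerticallyCoricGlobalData.ofKummerColumn lstar κ).prop310iii_frobenioids j (columnObjects Kf Kc)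
    (fun e => e) (fun m (σ : Kf m ≃+* Kc) => frakTransport σ)
    (fun m (σ : Kf m ≃+* Kf (m + 1)) => frakTransport σ)
    (fun m (σ : Kf m ≃+* Kf (m + 1)) (τ : Kf (m + 1) ≃+* Kc) => frakTransport_trans σ τ) (fun _ => rfl)

end KummerColumn

end GlobalFrobenioidModels

end Literature.IUT.LogThetaLattice
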